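import Literature.Analysis.FluidPDE.TorusNSVectorFieldHolder
import Literature.Analysis.FluidPDE.TorusClassicalNSTimeDerivLinearised
import Literature.Analysis.FluidPDE.TorusClassicalH1Balance
import Literature.Analysis.FunctionSpaces.TorusClassicalNSUniqueness
import Literature.Analysis.FunctionSpaces.TorusClassicalNSGluing
import HarnessLib

/-!
# The difference of the time derivatives of two Navier–Stokes solutions is the projected
# linearisation plus the projected quadratic defect

Analysis/FluidPDE proof file (theorems only; no definitions, no named facts), companion of
`TorusNSVectorFieldHolder.lean` (the projected vector field `G(u) = νΔu − P((u·∇)u)`,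
`P v = v − ∇Δ⁻¹div v` the smooth Leray–Helmholtz projection of `TorusLerayHelmholtzH1.lean`).
For two classical solutions `(u₁, p₁)`, `(u₂, p₂)` of the Navier–Stokes system on `[a, b] × T^d`
with the same viscosity and force, and `δ = u₁(t) − u₂(t)`, the difference of the (one-sided) time
derivatives is

  `∂ₜu₁(t) − ∂ₜu₂(t) = P( νΔδ − ((u₂·∇)δ + (δ·∇)u₂) − (δ·∇)δ )`      (`timeDerivWithin_sub_eq_leray`)

i.e. `G(u₁) − G(u₂) = DG(u₂)[δ] − P((δ·∇)δ)` written without ever inverting the pressure: the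
difference of the momentum equations gives `∂ₜδ + ∇(p₁ − p₂) = νΔδ − (u₂·∇)δ − (δ·∇)u₂ − (δ·∇)δ`
(`Torus.IsClassicalNSSolutionOn.timeDerivWithin_sub_eq`), the left side is a divergence-free field
plus a gradient, and the solenoidal part of a smooth field is unique (`Torus.helmholtz_unique`), so it
is the projection of the right side (Constantin–Foias 1988, Ch. 14, the equation for the difference;
Robinson–Rodrigo–Sadowski 2016, Thm. 2.6).  We also record that the projected linearisation
`P(νΔw − (u·∇)w − (w·∇)u)` of a divergence-free `w` along a divergence-free `u` is an honest state
(smooth, divergence free, zero mean: `isSmooth_/isDivFree_/hasZeroMean_leray_linearisation`), and the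
honesty of the Laplacian of an honest field.  These are the algebraic inputs of the `y`-derivative of
the time-derivative field of the smooth model of the NS semiflow (block N of the smooth-model
construction); the ESTIMATES are in `TorusNSLinearisationRemainderH1.lean`.

## Mathlib / tree search

Tree (reused): `Torus.IsClassicalNSSolutionOn.timeDerivWithin_sub_eq`, `….timeDerivWithin_sub`
(`TorusClassicalNSUniqueness`), `Torus.helmholtz_unique` (`TorusLerayHelmholtz`),
`Torus.isSmooth_/isDivFree_/hasZeroMean_sub_gradient_invLaplacian_divergence(_iff)` (`TorusLerayHelmholtzH1`),
`Torus.IsClassicalNSSolutionOn.isDivFree_timeDerivWithin`, `Torus.integral_fderiv_apply_eq_zero_of_isDivFree`,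
`Torus.integral_laplacian_eq_zero_of_isSmooth`, `Torus.IsDivFree.laplacian_of_isSmooth`.  Searched
`timeDerivWithin_sub.*invLaplacian`, `leray_linearis`, `nsVectorField` : only the Hölder estimate of
`TorusNSVectorFieldHolder` (no identity for the time derivatives).

## References

* P. Constantin, C. Foias, *Navier–Stokes Equations*, Univ. Chicago Press 1988, Ch. 14 (proof of
  Lemma 14.3: the equation of the difference). [ConstantinFoiasNSE1988]
* J. C. Robinson, J. L. Rodrigo, W. Sadowski, *The Three-Dimensional Navier–Stokes Equations*, CUP 2016,
  Thm. 2.6 and Lemma 2.9 (Leray projector). [RobinsonRodrigoSadowskiCUP2016]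
-/

noncomputable section

open _root_.MeasureTheory Set Filter Function UnitAddTorus
open scoped InnerProductSpace ContDiff Topology BigOperators

namespace Literature.Analysis.FluidPDE

namespace Torus

open Literature.Analysis.FunctionSpaces Literature.Analysis.FunctionSpaces.Torus

variable {d : Type*} [Fintype d] [DecidableEq d]

/-! ### Honest states: the projected linearisation and the Laplacian -/

section Honest

variable {u w : UnitAddTorus d → EuclideanSpace ℝ d}

/-- `∫ (u·∇)w = 0` for smooth `u, w` with `div u = 0` (transport identity). [folklore] -/
theorem integral_convect_eq_zero (hu : IsSmooth u) (hw : IsSmooth w) (hdiv : IsDivFree u) :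
    ∫ x, convect u w x = 0 :=
  integral_fderiv_apply_eq_zero_of_isDivFree hu hw hdiv

/-- The projected linearisation `P(νΔw − ((u·∇)w + (w·∇)u))` is smooth. [folklore] -/
theorem isSmooth_leray_linearisation (ν : ℝ) (hu : IsSmooth u) (hw : IsSmooth w) :
    IsSmooth (fun x => (ν • laplacian w x - (convect u w x + convect w u x)) -
      Torus.gradient (invLaplacian (divergence fun y => ν • laplacian w y - (convect u w y + convect w u y))) x) :=
  isSmooth_sub_gradient_invLaplacian_divergence ((hw.laplacian.smul ν).sub ((hu.convect hw).add (hw.convect hu)))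

/-- The projected linearisation `P(νΔw − ((u·∇)w + (w·∇)u))` is divergence free (`d` nonempty). [folklore] -/
theorem isDivFree_leray_linearisation [Nonempty d] (ν : ℝ) (hu : IsSmooth u) (hw : IsSmooth w) :
    IsDivFree (fun x => (ν • laplacian w x - (convect u w x + convect w u x)) -
      Torus.gradient (invLaplacian (divergence fun y => ν • laplacian w y - (convect u w y + convect w u y))) x) :=
  isDivFree_sub_gradient_invLaplacian_divergence ((hw.laplacian.smul ν).sub ((hu.convect hw).add (hw.convect hu)))

/-- The projected linearisation `P(νΔw − ((u·∇)w + (w·∇)u))` has zero mean when `div u = div w = 0`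
(`∫Δw = 0`, `∫(u·∇)w = ∫(w·∇)u = 0`, and `P` keeps the mean). [folklore] -/
theorem hasZeroMean_leray_linearisation (ν : ℝ) (hu : IsSmooth u) (hud : IsDivFree u) (hw : IsSmooth w)
    (hwd : IsDivFree w) :
    HasZeroMean (fun x => (ν • laplacian w x - (convect u w x + convect w u x)) -
      Torus.gradient (invLaplacian (divergence fun y => ν • laplacian w y - (convect u w y + convect w u y))) x) := by
  refine (hasZeroMean_sub_gradient_invLaplacian_divergence_iff
    (v := fun y => ν • laplacian w y - (convect u w y + convect w u y))
    ((hw.laplacian.smul ν).sub ((hu.convect hw).add (hw.convect hu)))).2 ?_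
  show ∫ x, (ν • laplacian w x - (convect u w x + convect w u x)) = 0
  have h1 : Integrable (fun x => ν • laplacian w x) volume := (hw.laplacian.continuous.const_smul ν).integrable_unitAddTorus
  have h2 : Integrable (fun x => convect u w x + convect w u x) volume :=
    ((hu.convect hw).continuous.add (hw.convect hu).continuous).integrable_unitAddTorus
  rw [integral_sub h1 h2, integral_add (hu.convect hw).integrable (hw.convect hu).integrable, integral_smul,
    integral_laplacian_eq_zero_of_isSmooth hw, integral_convect_eq_zero hu hw hud,
    integral_convect_eq_zero hw hu hwd]
  simp

/-- The Laplacian of an honest field (smooth, divergence free, zero mean) is honest. [folklore] -/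
theorem honest_laplacian (hw : IsSmooth w) (hwd : IsDivFree w) :
    IsSmooth (laplacian w) ∧ IsDivFree (laplacian w) ∧ HasZeroMean (laplacian w) :=
  ⟨hw.laplacian, IsDivFree.laplacian_of_isSmooth hw hwd, integral_laplacian_eq_zero_of_isSmooth hw⟩

end Honest

/-! ### The difference of the time derivatives of two solutions -/

section Difference

variable {a b ν : ℝ} {f u₁ u₂ : ℝ → UnitAddTorus d → EuclideanSpace ℝ d} {p₁ p₂ : ℝ → UnitAddTorus d → ℝ}

/-- **A divergence-free field which is a smooth field minus a gradient is the projection of that field**: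
if `Z` is smooth and divergence free, `π` is smooth and `Z + ∇π = Y` pointwise with `Y` smooth, then
`Z = P Y = Y − ∇Δ⁻¹div Y` (uniqueness of the solenoidal part, `Torus.helmholtz_unique`, `d` nonempty).
[cite: RobinsonRodrigoSadowskiCUP2016, Thm. 2.6 uniqueness (p. 44)] -/
theorem eq_leray_of_add_gradient_eq [Nonempty d] {Z Y : UnitAddTorus d → EuclideanSpace ℝ d} {π : UnitAddTorus d → ℝ}
    (hZ : IsSmooth Z) (hZd : IsDivFree Z) (hπ : IsSmooth π) (hY : IsSmooth Y) (h : ∀ x, Z x + Torus.gradient π x = Y x) :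
    Z = fun x => Y x - Torus.gradient (invLaplacian (divergence Y)) x := by
  refine helmholtz_unique hZ (isSmooth_sub_gradient_invLaplacian_divergence hY) hZd
    (isDivFree_sub_gradient_invLaplacian_divergence hY) hπ (isSmooth_invLaplacian hY.divergence) fun x => ?_
  rw [h x, sub_add_cancel]

/-- **The difference of the time derivatives of two Navier–Stokes solutions.**  For two classical solutions
`(u₁, p₁)`, `(u₂, p₂)` of NS_ν with the same force on `[a, b] × T^d` (`a < b`, `d` nonempty) and `t ∈ [a, b]`,
with `δ = u₁(t) − u₂(t)`:
`∂ₜu₁(t) − ∂ₜu₂(t) = P(νΔδ − ((u₂·∇)δ + (δ·∇)u₂) − (δ·∇)δ)` pointwise, `P v = v − ∇Δ⁻¹div v`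
(the difference equation `∂ₜδ + ∇(p₁ − p₂) = νΔδ − (u₁·∇)δ − (δ·∇)u₂`,
`Torus.IsClassicalNSSolutionOn.timeDerivWithin_sub_eq`, with `(u₁·∇)δ = (u₂·∇)δ + (δ·∇)δ`; its left side
is divergence free plus a gradient, so it is the projection of the right side, `Torus.eq_leray_of_add_gradient_eq`).
This is `G(u₁) − G(u₂) = DG(u₂)[δ] − P((δ·∇)δ)` for the projected vector field `G(u) = νΔu − P((u·∇)u) + f`.
[cite: ConstantinFoiasNSE1988, Ch. 14 Lemma 14.3 (14.10)] -/
theorem _root_.Literature.Analysis.FunctionSpaces.Torus.IsClassicalNSSolutionOn.timeDerivWithin_sub_eq_leray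
    [Nonempty d] (h₁ : IsClassicalNSSolutionOn (Icc a b) ν f u₁ p₁) (h₂ : IsClassicalNSSolutionOn (Icc a b) ν f u₂ p₂)
    (hab : a < b) {t : ℝ} (ht : t ∈ Icc a b) (x : UnitAddTorus d) :
    timeDerivWithin (Icc a b) u₁ t x - timeDerivWithin (Icc a b) u₂ t x =
      (ν • laplacian (fun z => u₁ t z - u₂ t z) x -
          (convect (u₂ t) (fun z => u₁ t z - u₂ t z) x + convect (fun z => u₁ t z - u₂ t z) (u₂ t) x) -
          convect (fun z => u₁ t z - u₂ t z) (fun z => u₁ t z - u₂ t z) x) -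
        Torus.gradient (invLaplacian (divergence fun y =>
          ν • laplacian (fun z => u₁ t z - u₂ t z) y -
            (convect (u₂ t) (fun z => u₁ t z - u₂ t z) y + convect (fun z => u₁ t z - u₂ t z) (u₂ t) y) -
            convect (fun z => u₁ t z - u₂ t z) (fun z => u₁ t z - u₂ t z) y)) x := by
  have hS : UniqueDiffOn ℝ (Icc a b) := uniqueDiffOn_Icc hab
  have hu₁ : IsSmooth (u₁ t) := h₁.smooth_velocity.isSmooth_slice ht
  have hu₂ : IsSmooth (u₂ t) := h₂.smooth_velocity.isSmooth_slice ht
  have hδ : IsSmooth (fun z => u₁ t z - u₂ t z) := hu₁.sub hu₂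
  have hπ : IsSmooth (fun z => p₁ t z - p₂ t z) :=
    (h₁.smooth_pressure.isSmooth_slice ht).sub (h₂.smooth_pressure.isSmooth_slice ht)
  -- the difference of the time derivatives: smooth and divergence free
  have hZs : IsSmooth (fun y => timeDerivWithin (Icc a b) u₁ t y - timeDerivWithin (Icc a b) u₂ t y) :=
    (h₁.smooth_velocity.isSmooth_timeDerivWithin hS ht).sub (h₂.smooth_velocity.isSmooth_timeDerivWithin hS ht)
  have hZd : IsDivFree (fun y => timeDerivWithin (Icc a b) u₁ t y - timeDerivWithin (Icc a b) u₂ t y) := by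
    intro y
    rw [show (fun y => timeDerivWithin (Icc a b) u₁ t y - timeDerivWithin (Icc a b) u₂ t y) =
        timeDerivWithin (Icc a b) u₁ t - timeDerivWithin (Icc a b) u₂ t from rfl,
      divergence_sub ((h₁.smooth_velocity.isSmooth_timeDerivWithin hS ht).isContDiff (by simp))
        ((h₂.smooth_velocity.isSmooth_timeDerivWithin hS ht).isContDiff (by simp)),
      h₁.isDivFree_timeDerivWithin hab ht y, h₂.isDivFree_timeDerivWithin hab ht y, sub_zero]
  -- the right side is smooth
  have hY : IsSmooth (fun y => ν • laplacian (fun z => u₁ t z - u₂ t z) y -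
      (convect (u₂ t) (fun z => u₁ t z - u₂ t z) y + convect (fun z => u₁ t z - u₂ t z) (u₂ t) y) -
      convect (fun z => u₁ t z - u₂ t z) (fun z => u₁ t z - u₂ t z) y) :=
    ((hδ.laplacian.smul ν).sub ((hu₂.convect hδ).add (hδ.convect hu₂))).sub (hδ.convect hδ)
  -- the difference equation `∂ₜδ + ∇π = Y`
  have heq : ∀ y, (timeDerivWithin (Icc a b) u₁ t y - timeDerivWithin (Icc a b) u₂ t y) +
      Torus.gradient (fun z => p₁ t z - p₂ t z) y =
      ν • laplacian (fun z => u₁ t z - u₂ t z) y -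
        (convect (u₂ t) (fun z => u₁ t z - u₂ t z) y + convect (fun z => u₁ t z - u₂ t z) (u₂ t) y) -
        convect (fun z => u₁ t z - u₂ t z) (fun z => u₁ t z - u₂ t z) y := by
    intro y
    have hL : laplacian (u₁ t) y - laplacian (u₂ t) y = laplacian (fun z => u₁ t z - u₂ t z) y := by
      rw [show (fun z => u₁ t z - u₂ t z) = u₁ t - u₂ t from rfl, laplacian_sub hu₁ hu₂, Pi.sub_apply]
    -- `(u₁·∇)δ = (u₂·∇)δ + (δ·∇)δ`
    have hsplit : convect (u₁ t) (fun z => u₁ t z - u₂ t z) y =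
        convect (u₂ t) (fun z => u₁ t z - u₂ t z) y +
          convect (fun z => u₁ t z - u₂ t z) (fun z => u₁ t z - u₂ t z) y := by
      simp only [convect]
      rw [← map_add, add_sub_cancel]
    rw [← h₁.timeDerivWithin_sub h₂ hab ht y, h₁.timeDerivWithin_sub_eq h₂ hab ht y, hL, hsplit]
    abel
  have h := eq_leray_of_add_gradient_eq hZs hZd hπ hY heq
  exact congrFun h x

end Difference

end Torus

end Literature.Analysis.FluidPDE

end
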